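import Summits.Parity.GeneralizedHardyLittlewood.Theorems.LeeYangFibresPrimeCellsRelativeSieveOutToChowlaAt
import Summits.Parity.GeneralizedHardyLittlewood.Theorems.LeeYangFibresPrimeCellsRelativeChowlaFromOpening
import Summits.Parity.GeneralizedHardyLittlewood.Theorems.LeeYangFibresPrimeCellsRelativeDicksonAt
import Summits.Parity.GeneralizedHardyLittlewood.Theorems.LeeYangFibresPrimeCellsRelativeChowlaHardness
import Summits.Parity.GeneralizedHardyLittlewood.Theorems.LeeYangFibresPrimeCellsRelativeGoldbachAt
import HarnessLib

/-!
# Route `LeeYangFibres`, crux `PrimeCellsRelative` (stmt-Parity-14112), line `SketchIdeator4`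
# (card `sieve-out-to-chowla`): the PAIR PACKAGE — what the line gives for twin primes, and from which
# conjectural inputs exactly

The line theorem (`primeCellsRelative_of_cellParityLaw_of_liouvilleTupleMeanPos`, p119571) localises in the
number of forms (`primeCellsRelativeAt_of_cellParityLawAt`, p121321): for every `t ≥ 1`,
`CellParityLawAt t → LiouvilleTupleMeanPos t → PrimeCellsRelativeAt t`.  At `t = 2` the parity input
`LiouvilleTupleMeanPos 2` (a Bombieri–Vinogradov mean value for the pair Chowla sequence `λ(ψ₁(n))λ(ψ₂(n))` on
positive intervals, level `N^η`, log-power saving) is supplied by the CRUX OF ANOTHER ROUTE plus a clean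
natural-density statement (`liouvilleTupleMeanPos_two_of_relativeChowlaLevel`, p121142): route `LiouvilleOpening`'s
`RelativeChowlaLevel` (item stmt-Parity-16148: relative level of distribution `N^{1-δ}` of the pair Chowla sequence,
mean-free, parity-neutral) and a log-power pair Chowla on intervals (`|Σ_{n ∈ [u,v]} λ(ψ₁(n))λ(ψ₂(n))| ≤ C N/(log N)^A`
for every `A`, uniformly over non-degenerate pair systems with `‖Ψ‖_N ≤ L` — the log-power form of that route's
`ChowlaNatural`, stmt-Parity-16149).  Composing by name:

* `primeCellsRelativeAt_two_of_pairInputs` (registered sub-goal of stmt-Parity-14112) —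
  **`CellParityLawAt 2 → RelativeChowlaLevel → (log-power pair Chowla) → PrimeCellsRelativeAt 2`**: Bombieri's
  pair cell-parity law, the relative level of the pair Chowla sequence and log-power natural-density pair Chowla
  imply the counting Hardy–Littlewood law for every rough prime PAIR cell (twins, Sophie Germain, `(n, N − n)`)
  with Green–Tao's relative + absolute error, uniformly in the shifts;
* `twinPrimeConjecture_of_pairInputs` — hence the twin prime conjecture (through
  `twinPrimeConjecture_of_primeCellsRelativeAt_two`, p121518);
* `hardyLittlewoodGoldbach_of_pairInputs`, `eventual_goldbach_of_pairInputs`, `sophieGermain_infinite_of_pairInputs`,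
  `prime_and_prime_add_infinite_of_primeCellsRelativeAt_two` — Hardy–Littlewood's Conjecture A, binary Goldbach for
  large even `N`, Sophie Germain primes and de Polignac pairs from the same inputs (appended; Goldbach slice p121698);
* `chowla_two_of_pairInputs` — and, for the record, the price tag: the same three inputs contain natural-density
  `2`-point Chowla (`liouvilleCorrelation_isLittleO_of_liouvilleTupleMeanPos`, p120414), so nothing here is cheaper
  than Chowla's conjecture for pairs.

Everything is conditional: the three inputs are conjecture-grade (crux 3 of this route at `t = 2`; crux 16148 of
route `LiouvilleOpening`; log-power `ChowlaNatural`), and none of them mentions a prime.  No new definitions.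
References: Bombieri 1976 [BombieriAsymptoticSieve1976]; Green–Tao 2010 Conj. 1.4 [GreenTao2010]; Tao 2016
[TaoFMP2016]; Hardy–Littlewood 1923 [HardyLittlewood1923].
-/

noncomputable section

open scoped BigOperators Classical
open Finset Filter

namespace Summit.Parity.GeneralizedHardyLittlewood.Cruxes.PrimeCellsRelative.SieveOutToChowla

open Literature.NumberTheory.Sieve
open Summit.Parity.GeneralizedHardyLittlewood.Theses.LeeYangFibres

/-- **The pair package (registered sub-goal of stmt-Parity-14112).** Bombieri's cell-parity law for pairs
(`CellParityLawAt 2`), the relative level of distribution of the pair Chowla sequence (route `LiouvilleOpening`'s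
crux `RelativeChowlaLevel`, stmt-Parity-16148) and log-power natural-density pair Chowla on intervals imply the
pair slice of the crux, `PrimeCellsRelativeAt 2`: composition of `liouvilleTupleMeanPos_two_of_relativeChowlaLevel`
(p121142) with `primeCellsRelativeAt_two_of_cellParityLawAt_two` (p121321). [folklore] -/
theorem primeCellsRelativeAt_two_of_pairInputs : CellParityLawAt 2 → Summit.Parity.GeneralizedHardyLittlewood.Theses.LiouvilleOpening.RelativeChowlaLevel → (∀ (L : ℕ) (A : ℝ), ∃ (C : ℝ) (N₀ : ℕ), ∀ N : ℕ, N₀ ≤ N → ∀ Ψ : Fin 2 → AffLinForm 1, IsNondegenerateSystem Ψ → affLinSize Ψ N ≤ L → ∀ u v : ℤ, -(N : ℤ) ≤ u → v ≤ N → |∑ n ∈ Finset.Icc u v, ∏ i, ((ArithmeticFunction.liouville (Int.toNat ((Ψ i).eval fun _ => n)) : ℤ) : ℝ)| ≤ C * (N : ℝ) / Real.log N ^ A) → PrimeCellsRelativeAt 2 :=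
  fun hLaw hLevel hChowla =>
    primeCellsRelativeAt_two_of_cellParityLawAt_two hLaw
      (liouvilleTupleMeanPos_two_of_relativeChowlaLevel hLevel hChowla)

/-- **Twin primes from the pair package**: `CellParityLawAt 2 ∧ RelativeChowlaLevel ∧ (log-power pair Chowla) ⟹
TwinPrimeConjecture` (through `twinPrimeConjecture_of_primeCellsRelativeAt_two`, p121518).
[cite: HardyLittlewood1923, Conjecture B] -/
theorem twinPrimeConjecture_of_pairInputs (hLaw : CellParityLawAt 2)
    (hLevel : Summit.Parity.GeneralizedHardyLittlewood.Theses.LiouvilleOpening.RelativeChowlaLevel)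
    (hChowla : ∀ (L : ℕ) (A : ℝ), ∃ (C : ℝ) (N₀ : ℕ), ∀ N : ℕ, N₀ ≤ N → ∀ Ψ : Fin 2 → AffLinForm 1,
      IsNondegenerateSystem Ψ → affLinSize Ψ N ≤ L → ∀ u v : ℤ, -(N : ℤ) ≤ u → v ≤ N →
      |∑ n ∈ Finset.Icc u v, ∏ i, ((ArithmeticFunction.liouville (Int.toNat ((Ψ i).eval fun _ => n)) : ℤ) : ℝ)| ≤
        C * (N : ℝ) / Real.log N ^ A) :
    TwinPrimeConjecture :=
  twinPrimeConjecture_of_primeCellsRelativeAt_two (primeCellsRelativeAt_two_of_pairInputs hLaw hLevel hChowla)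

/-- **The price tag of the pair package**: its two parity inputs already contain natural-density `2`-point Chowla
for every pair of distinct shifts (`liouvilleCorrelation_isLittleO_of_liouvilleTupleMeanPos` at `k = 2`, p120414) —
recorded so that the conditional results above are read at their true strength. [cite: Chowla1965] -/
theorem chowla_two_of_pairInputs
    (hLevel : Summit.Parity.GeneralizedHardyLittlewood.Theses.LiouvilleOpening.RelativeChowlaLevel)
    (hChowla : ∀ (L : ℕ) (A : ℝ), ∃ (C : ℝ) (N₀ : ℕ), ∀ N : ℕ, N₀ ≤ N → ∀ Ψ : Fin 2 → AffLinForm 1,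
      IsNondegenerateSystem Ψ → affLinSize Ψ N ≤ L → ∀ u v : ℤ, -(N : ℤ) ≤ u → v ≤ N →
      |∑ n ∈ Finset.Icc u v, ∏ i, ((ArithmeticFunction.liouville (Int.toNat ((Ψ i).eval fun _ => n)) : ℤ) : ℝ)| ≤
        C * (N : ℝ) / Real.log N ^ A)
    (h : Fin 2 → ℕ) (hinj : Function.Injective h) :
    (fun x : ℕ => (liouvilleCorrelation h x : ℝ)) =o[Filter.atTop] fun x => (x : ℝ) :=
  liouvilleCorrelation_isLittleO_of_liouvilleTupleMeanPos le_rfl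
    (liouvilleTupleMeanPos_two_of_relativeChowlaLevel hLevel hChowla) h hinj

/-- **The line's in-arrow to the node, pair slice, in one statement**: for systems of two forms the crux
`PrimeCellsRelative` is reached from crux 3 of this route and crux 16148 of route `LiouvilleOpening` plus log-power
pair Chowla — no zero-locus hypothesis (`FibreHyperbolicity`) and no `k`-point input for `k ≥ 3`.  Equivalent
curried form of `primeCellsRelativeAt_two_of_pairInputs`. [folklore] -/
theorem primeCellsRelativeAt_two_of_pairInputs' (hLaw : CellParityLawAt 2)
    (hLevel : Summit.Parity.GeneralizedHardyLittlewood.Theses.LiouvilleOpening.RelativeChowlaLevel)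
    (hChowla : ∀ (L : ℕ) (A : ℝ), ∃ (C : ℝ) (N₀ : ℕ), ∀ N : ℕ, N₀ ≤ N → ∀ Ψ : Fin 2 → AffLinForm 1,
      IsNondegenerateSystem Ψ → affLinSize Ψ N ≤ L → ∀ u v : ℤ, -(N : ℤ) ≤ u → v ≤ N →
      |∑ n ∈ Finset.Icc u v, ∏ i, ((ArithmeticFunction.liouville (Int.toNat ((Ψ i).eval fun _ => n)) : ℤ) : ℝ)| ≤
        C * (N : ℝ) / Real.log N ^ A) :
    PrimeCellsRelativeAt 2 :=
  primeCellsRelativeAt_two_of_pairInputs hLaw hLevel hChowla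

/-! ## More pair content from the pair slice alone (appended by the lead c6-0): Sophie Germain primes and
de Polignac pairs

`dickson_injective_of_primeCellsRelativeAt` (p121518) at `t = 2` with the admissible injective families `(n, 2n + 1)` and
`(n, n + k)`, `k` even — the admissibility computations are those of
`Literature.NumberTheory.Sieve.DicksonConjecture.setOf_sophieGermain_infinite` / `…setOf_prime_and_prime_add_infinite`
(which need Dickson's conjecture for all `k`; here the PAIR slice of the crux suffices). -/

/-- **The pair slice of the crux gives infinitely many Sophie Germain primes** (`p` and `2p + 1` prime; registered
sub-goal of stmt-Parity-14112): the family `(n, 2n + 1)` is injective and admissible (`n = 1` gives the product `3`,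
`n = 2` gives `10`). [cite: Ribenboim1989, Ch. 6 §I (D₂) and the remark following it] -/
theorem sophieGermain_infinite_of_primeCellsRelativeAt_two : PrimeCellsRelativeAt 2 → {p : ℕ | p.Prime ∧ (2 * p + 1).Prime}.Infinite := by
  intro hP
  refine Set.infinite_of_forall_exists_gt fun M₀ => ?_
  have ha : ∀ i : Fin 2, 1 ≤ (![1, 2] : Fin 2 → ℕ) i := by
    intro i
    fin_cases i <;> simp
  have hinj : Function.Injective fun i : Fin 2 => ((![1, 2] : Fin 2 → ℕ) i, (![0, 1] : Fin 2 → ℕ) i) := by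
    intro i j hij
    fin_cases i <;> fin_cases j <;> simp_all
  have hadm : ∀ p : ℕ, p.Prime → ∃ n : ℕ, ¬p ∣ ∏ i, ((![1, 2] : Fin 2 → ℕ) i * n + (![0, 1] : Fin 2 → ℕ) i) := by
    intro p hp
    by_cases h3 : p = 3
    · subst h3
      refine ⟨2, ?_⟩
      rw [Fin.prod_univ_two]
      decide
    · refine ⟨1, fun hdvd => h3 ?_⟩
      rw [Fin.prod_univ_two] at hdvd
      simp only [Matrix.cons_val_zero, Matrix.cons_val_one, mul_one, add_zero, one_mul] at hdvd
      exact (Nat.prime_dvd_prime_iff_eq hp Nat.prime_three).mp (by simpa using hdvd)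
  obtain ⟨m, hm, hprime⟩ :=
    dickson_injective_of_primeCellsRelativeAt hP (by norm_num) ![1, 2] ![0, 1] ha hinj hadm M₀
  refine ⟨m, ⟨?_, ?_⟩, hm⟩
  · simpa using hprime 0
  · simpa using hprime 1

/-- **The pair slice of the crux gives de Polignac's prime pairs**: for every even `k` there are infinitely many
primes `p` with `p + k` prime (`k = 2`: twins, `twinPrimeConjecture_of_primeCellsRelativeAt_two`; `k = 0`: trivial).  The
family `(n, n + k)` is injective for `k ≠ 0` and admissible (`n = 1` gives `1 + k`; a prime `p ∣ 1 + k` is odd and does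
not divide `2 (2 + k)`). [cite: Ribenboim1989, Ch. 6 §I (Polignac's conjecture as a consequence of (D))] -/
theorem prime_and_prime_add_infinite_of_primeCellsRelativeAt_two (hP : PrimeCellsRelativeAt 2) {k : ℕ}
    (hk : Even k) : {p : ℕ | p.Prime ∧ (p + k).Prime}.Infinite := by
  rcases eq_or_ne k 0 with rfl | hk0
  · simpa using Nat.infinite_setOf_prime
  refine Set.infinite_of_forall_exists_gt fun M₀ => ?_
  have ha : ∀ i : Fin 2, 1 ≤ (![1, 1] : Fin 2 → ℕ) i := by
    intro i
    fin_cases i <;> simp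
  have hinj : Function.Injective fun i : Fin 2 => ((![1, 1] : Fin 2 → ℕ) i, (![0, k] : Fin 2 → ℕ) i) := by
    intro i j hij
    fin_cases i <;> fin_cases j <;> simp_all
  have hadm : ∀ p : ℕ, p.Prime → ∃ n : ℕ, ¬p ∣ ∏ i, ((![1, 1] : Fin 2 → ℕ) i * n + (![0, k] : Fin 2 → ℕ) i) := by
    intro p hp
    by_cases hpk : p ∣ 1 + k
    · refine ⟨2, fun hdvd => ?_⟩
      have h' : p ∣ 2 * (2 + k) := by simpa [Fin.prod_univ_two] using hdvd
      have hp2 : p ≠ 2 := by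
        rintro rfl
        obtain ⟨r, hr⟩ := hk
        omega
      rcases (Nat.Prime.dvd_mul hp).1 h' with h2 | h2k
      · exact hp2 ((Nat.prime_dvd_prime_iff_eq hp Nat.prime_two).1 h2)
      · have h1 : p ∣ 1 := by
          have := Nat.dvd_sub h2k hpk
          rwa [show 2 + k - (1 + k) = 1 by omega] at this
        exact hp.one_lt.ne' (Nat.dvd_one.1 h1)
    · refine ⟨1, fun hdvd => hpk ?_⟩
      simpa [Fin.prod_univ_two] using hdvd
  obtain ⟨m, hm, hprime⟩ :=
    dickson_injective_of_primeCellsRelativeAt hP (by norm_num) ![1, 1] ![0, k] ha hinj hadm M₀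
  refine ⟨m, ⟨?_, ?_⟩, hm⟩
  · simpa using hprime 0
  · simpa using hprime 1

/-- **Sophie Germain primes from the pair package** (`CellParityLawAt 2 ∧ RelativeChowlaLevel ∧ log-power pair Chowla`).
[folklore] -/
theorem sophieGermain_infinite_of_pairInputs (hLaw : CellParityLawAt 2)
    (hLevel : Summit.Parity.GeneralizedHardyLittlewood.Theses.LiouvilleOpening.RelativeChowlaLevel)
    (hChowla : ∀ (L : ℕ) (A : ℝ), ∃ (C : ℝ) (N₀ : ℕ), ∀ N : ℕ, N₀ ≤ N → ∀ Ψ : Fin 2 → AffLinForm 1,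
      IsNondegenerateSystem Ψ → affLinSize Ψ N ≤ L → ∀ u v : ℤ, -(N : ℤ) ≤ u → v ≤ N →
      |∑ n ∈ Finset.Icc u v, ∏ i, ((ArithmeticFunction.liouville (Int.toNat ((Ψ i).eval fun _ => n)) : ℤ) : ℝ)| ≤
        C * (N : ℝ) / Real.log N ^ A) :
    {p : ℕ | p.Prime ∧ (2 * p + 1).Prime}.Infinite :=
  sophieGermain_infinite_of_primeCellsRelativeAt_two (primeCellsRelativeAt_two_of_pairInputs hLaw hLevel hChowla)

/-! ## Hardy–Littlewood's Conjecture A from the pair package (appended once the Goldbach slice p121698 landed) -/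

/-- **Hardy–Littlewood's Goldbach asymptotic from the pair package**: `CellParityLawAt 2 ∧ RelativeChowlaLevel ∧
(log-power pair Chowla) ⟹ HardyLittlewoodGoldbach` (parity.S35), through the pair slice and
`hardyLittlewoodGoldbach_of_primeCellsRelativeAt_two` (p121698) — the shift-uniformity `‖Ψ‖_N ≤ 3` of the slice is
what lets ONE threshold serve every even `N`. [cite: HardyLittlewoodPN3, §4.1 Conjecture A (4.11)–(4.12) p. 32] -/
theorem hardyLittlewoodGoldbach_of_pairInputs (hLaw : CellParityLawAt 2)
    (hLevel : Summit.Parity.GeneralizedHardyLittlewood.Theses.LiouvilleOpening.RelativeChowlaLevel)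
    (hChowla : ∀ (L : ℕ) (A : ℝ), ∃ (C : ℝ) (N₀ : ℕ), ∀ N : ℕ, N₀ ≤ N → ∀ Ψ : Fin 2 → AffLinForm 1,
      IsNondegenerateSystem Ψ → affLinSize Ψ N ≤ L → ∀ u v : ℤ, -(N : ℤ) ≤ u → v ≤ N →
      |∑ n ∈ Finset.Icc u v, ∏ i, ((ArithmeticFunction.liouville (Int.toNat ((Ψ i).eval fun _ => n)) : ℤ) : ℝ)| ≤
        C * (N : ℝ) / Real.log N ^ A) :
    HardyLittlewoodGoldbach :=
  hardyLittlewoodGoldbach_of_primeCellsRelativeAt_two (primeCellsRelativeAt_two_of_pairInputs hLaw hLevel hChowla)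

/-- **Binary Goldbach for all large even `N` from the pair package.** [cite: HardyLittlewoodPN3, §4.1 Conjecture A p. 32] -/
theorem eventual_goldbach_of_pairInputs (hLaw : CellParityLawAt 2)
    (hLevel : Summit.Parity.GeneralizedHardyLittlewood.Theses.LiouvilleOpening.RelativeChowlaLevel)
    (hChowla : ∀ (L : ℕ) (A : ℝ), ∃ (C : ℝ) (N₀ : ℕ), ∀ N : ℕ, N₀ ≤ N → ∀ Ψ : Fin 2 → AffLinForm 1,
      IsNondegenerateSystem Ψ → affLinSize Ψ N ≤ L → ∀ u v : ℤ, -(N : ℤ) ≤ u → v ≤ N →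
      |∑ n ∈ Finset.Icc u v, ∏ i, ((ArithmeticFunction.liouville (Int.toNat ((Ψ i).eval fun _ => n)) : ℤ) : ℝ)| ≤
        C * (N : ℝ) / Real.log N ^ A) :
    ∃ N₀ : ℕ, ∀ N : ℕ, N₀ ≤ N → Even N → ∃ p q : ℕ, p.Prime ∧ q.Prime ∧ p + q = N :=
  eventual_goldbach_of_primeCellsRelativeAt_two (primeCellsRelativeAt_two_of_pairInputs hLaw hLevel hChowla)

end Summit.Parity.GeneralizedHardyLittlewood.Cruxes.PrimeCellsRelative.SieveOutToChowla

end
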